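import Summits.HodgeConjecture.HodgeConjecture.Theorems.Ring2AbelianAllTypeIIIFourfoldsKernel
import Literature.AlgebraicGeometry.HodgeTheory.SimpleAbelianSurfacePowersHodgeClasses
import Literature.AlgebraicGeometry.HodgeTheory.FiniteProductsMixedPowersRetract
import Literature.AlgebraicGeometry.HodgeTheory.HodgeConjectureAbelianSubquotients
import Literature.AlgebraicGeometry.HodgeTheory.HodgeConjectureIsogenyInvariance
import HarnessLib

/-!
# Ring 2 · Weil-type family-coverage census (ring2-b05, gen 58) — ALL POWERS OF AN ABELIAN VARIETY ISOGENOUS TO A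
  POWER: the two dicyclic `g = 8` sub-loci shapes `P ~ B⁴` (simple abelian surface) and `P ~ X²` (type III(1) fourfold)

research route conditional on HC_CM; not a corollary; Q11.4-sentence-2 already refuted in dim ≥ 3.
`HC_CM` (`Theses.RankFourFaces.CMAbelianHodge`, by name) does not occur in this file; no case of the Hodge conjecture is
claimed beyond the cited theorems. Cell `pub-hodge-ring2`, seat `ring2-b05` (census «## b05 (g ≥ 8 / powers)», block
b05.14: the POWERS column on ring2-b02's dicyclic `g = 8` Prym loci of b02.16 P.S. / P.S. 2). No definition, no named
fact introduced, no `sorry`.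

THE SHAPES. ring2-b02's monodromy certificates (census b02.16 P.S. (C1)–(C3), P.S. 2 (D)) put on certain one-dimensional
dicyclic Prym loci inside the SPLIT Weil eightfold components `W8.d.1` members of the shape `P_t ~ B_t⁴` (`B_t` an abelian
surface, at EVERY member; Shimura's exceptional case) resp. `P_t ~ X_t²` (`X_t` a fourfold with a definite quaternion
algebra `B ⊂ End⁰(X_t)` acting compatibly with the polarisation; the `Q₁₆` datum `(0;4,4,8,8)`). This file records, as
kernel theorems, what the tree already knows about ALL POWERS of such `P`:

* §1 `hodgeConjectureFor_powSucc_powSucc_of_forall`, `hodgeConjectureFor_powSucc_of_isIsogenous_powSucc_of_forall`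
  (and the `B = D` twin): if the Hodge conjecture holds for every power of `X`, it holds for every power of every `P`
  isogenous to a power of `X` — `(X^{a+1})^{b+1}` is a retract of `X^{(a+1)(b+1)}` (the tree's `powPowIncl` /
  `powPowProj`, `FiniteProductsMixedPowersRetract`), van Geemen's Lemma 3.7 (`HodgeConjectureFor.of_comp_eq_nsmul_id`,
  `HodgeConjectureFor.of_isIsogenous`) and `Pohlmann1968.isIsogenous_powSucc`.
* §2 `hodgeConjectureFor_powSucc_of_isIsogenous_powSucc_of_isSimple_surface` — **UNCONDITIONAL: every power of every
  complex abelian variety isogenous to a power of a SIMPLE abelian surface satisfies the Hodge conjecture** (indeed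
  `B = D`: `isDivisorGenerated_powSucc_of_isIsogenous_powSucc_of_isSimple_surface`), by the tree's THEOREM
  `AbelianVariety.isDivisorGenerated_powSucc_of_isSimple_surface` (Moonen–Zarhin 1999 §2 (2.2), Tankeev–Ribet at
  `p = 2`, proved in `SimpleAbelianSurfacePowersHodgeClasses`). In print for EVERY abelian surface: Abdulali 2016 §8.1
  (2) «the general Hodge conjecture is true for any power of an abelian surface».
* §3 `hodgeConjectureFor_powSucc_of_isIsogenous_powSucc_of_hasCompatibleQuaternionPair` — modulo ONE refereed named
  fact, Floccari–Fu 2026 Thm. 1.2 (binder `h5`, never asserted): every power of every `P` isogenous to a power of an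
  abelian fourfold `X` with a compatible definite quaternion pair (`Ring2.AbelianAll.HasCompatibleQuaternionPair`,
  ab-weil-2's Lemma R1 `hodgeConjectureFor_powSucc_of_floccariFu_of_hasCompatibleQuaternionPair`) satisfies the Hodge
  conjecture; `…_sq_…` the square. In print when `B ∋ √-1` or `√-3`: Abdulali 2002 Cor. 4.3 = Abdulali 2016 App. A 2(a)
  (for the `Q₁₆` datum the census computes `B = (-1,-1)_ℚ`).

## References
* [vanGeemen1994HodgeAV] B. van Geemen, LNM 1594 (1994), §2.4–2.5, Lemma 3.7, Thm. 4.6.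
* [MoonenZarhin1999LowDim] B. Moonen, Yu. Zarhin, Math. Ann. 315 (1999), §2 (2.2) and Thm. 0.1.
* [Abdulali2016TateTwists] S. Abdulali, in: Recent Advances in Hodge Theory (CUP 2016), §8.1 (2) and Appendix A 2(a).
* [FloccariFu2026] S. Floccari, L. Fu, J. Math. Pures Appl. 210 (2026) 103876, Thm. 1.2.
* [MumfordAV1970] D. Mumford, Abelian Varieties (1970), §19, §21 Thm. 2.
* [Milne1986AbelianVarieties] J. S. Milne, Abelian varieties, in: Arithmetic Geometry (1986), §12.
-/

set_option linter.dupNamespace false -- `Summit.HodgeConjecture.HodgeConjecture.…` (summit = problem) trips it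

noncomputable section

open CategoryTheory

namespace Summit.HodgeConjecture.HodgeConjecture.Ring2.WeilCoverage

open Literature.AlgebraicGeometry Literature.AlgebraicGeometry.Motives
open Literature.AlgebraicGeometry.HodgeTheory
open Literature.AlgebraicTopology.SingularHomology
open Summit.HodgeConjecture.HodgeConjecture.Ring2.AbelianAll

variable {X P : AbelianVariety ℂ}

/-! ### §1 Powers of a variety isogenous to a power -/

/-- **`HC` for every power of `X` ⟹ `HC` for `(X^{a+1})^{b+1}`**: the regrouped power is a retract of
`X^{(a+1)(b+1)} = X.powSucc (a + b(a+1))` (`powPowIncl ≫ powPowProj = 𝟙`), and the Hodge conjecture passes to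
isogeny direct summands (van Geemen Lemma 3.7). [cite: vanGeemen1994HodgeAV, Lemma 3.7 (p. 236)]
[cite: MumfordAV1970, §19 (Hom(C, A × B) = Hom(C, A) ⊕ Hom(C, B))] -/
theorem hodgeConjectureFor_powSucc_powSucc_of_forall
    (h : ∀ n : ℕ, HodgeConjectureFor (X.powSucc n).dim (X.powSucc n).X) (a b : ℕ) :
    HodgeConjectureFor ((X.powSucc a).powSucc b).dim ((X.powSucc a).powSucc b).X :=
  HodgeConjectureFor.of_comp_eq_nsmul_id (powPowIncl X a b) (powPowProj X a b) one_ne_zero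
    (by rw [powPowIncl_comp_powPowProj, one_smul]) (h _)

/-- **`HC` for every power of `X` ⟹ `HC` for every power of every `P` isogenous to a power of `X`**
(`P^{k+1} ∼ (X^{N+1})^{k+1}`, a retract of `X^{(N+1)(k+1)}`). [cite: vanGeemen1994HodgeAV, Lemma 3.7 (p. 236)]
[cite: Milne1986AbelianVarieties, §12 p. 122] -/
theorem hodgeConjectureFor_powSucc_of_isIsogenous_powSucc_of_forall {N : ℕ} (hP : P.IsIsogenous (X.powSucc N))
    (h : ∀ n : ℕ, HodgeConjectureFor (X.powSucc n).dim (X.powSucc n).X) (k : ℕ) :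
    HodgeConjectureFor (P.powSucc k).dim (P.powSucc k).X :=
  HodgeConjectureFor.of_isIsogenous (Pohlmann1968.isIsogenous_powSucc hP k)
    (hodgeConjectureFor_powSucc_powSucc_of_forall h N k)

/-- **`B = D` twin**: if every power of `X` has a divisor-generated Hodge ring, so does every power of every `P`
isogenous to a power of `X`. [cite: vanGeemen1994HodgeAV, §2.4–2.5 (p. 235) and §3.6–3.7 (p. 236)]
[cite: Milne1986AbelianVarieties, §12 p. 122] -/
theorem isDivisorGenerated_powSucc_of_isIsogenous_powSucc_of_forall {N : ℕ} (hP : P.IsIsogenous (X.powSucc N))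
    (h : ∀ n : ℕ, IsDivisorGenerated (X.powSucc n)) (k : ℕ) : IsDivisorGenerated (P.powSucc k) :=
  (IsDivisorGenerated.powSucc_powSucc_of_powSucc (h _)).of_isIsogenous (Pohlmann1968.isIsogenous_powSucc hP k)

/-! ### §2 `P ~ B^{N+1}`, `B` a simple abelian surface — UNCONDITIONAL -/

/-- **`B = D` on every power of every abelian variety isogenous to a power of a SIMPLE complex abelian SURFACE**
(Moonen–Zarhin 1999 §2 (2.2): the four endomorphism types I(1), I(2), II(1), IV(2,1) all have `Hg = Sp_D`, no type
III; the tree's theorem `AbelianVariety.isDivisorGenerated_powSucc_of_isSimple_surface`). The census shape: the very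
general member `P_t ~ B_t⁴` of ring2-b02's case-(α) dicyclic loci with a certified split `Q₂` (`B_t` a simple RM
surface). [cite: MoonenZarhin1999LowDim, §2 p. 715 and (2.2)] [cite: vanGeemen1994HodgeAV, §2.4–2.5 and §3.6–3.7] -/
theorem isDivisorGenerated_powSucc_of_isIsogenous_powSucc_of_isSimple_surface {B : AbelianVariety ℂ}
    (hB : B.IsSimple) (hdim : B.dim = 2) {N : ℕ} (hP : P.IsIsogenous (B.powSucc N)) (k : ℕ) :
    IsDivisorGenerated (P.powSucc k) :=
  isDivisorGenerated_powSucc_of_isIsogenous_powSucc_of_forall hP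
    (AbelianVariety.isDivisorGenerated_powSucc_of_isSimple_surface B hB hdim) k

/-- **THE HODGE CONJECTURE FOR EVERY POWER OF EVERY ABELIAN VARIETY ISOGENOUS TO A POWER OF A SIMPLE ABELIAN
SURFACE — UNCONDITIONAL** (`B = D` + Lefschetz `(1,1)`). In print, for every abelian surface: «the general Hodge
conjecture is true for any power of an abelian surface». [cite: MoonenZarhin1999LowDim, §2 p. 715 and (2.2)]
[cite: Abdulali2016TateTwists, §8.1 (2)] [cite: vanGeemen1994HodgeAV, Lemma 3.7 and Thm. 4.6] -/
theorem hodgeConjectureFor_powSucc_of_isIsogenous_powSucc_of_isSimple_surface {B : AbelianVariety ℂ}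
    (hB : B.IsSimple) (hdim : B.dim = 2) {N : ℕ} (hP : P.IsIsogenous (B.powSucc N)) (k : ℕ) :
    HodgeConjectureFor (P.powSucc k).dim (P.powSucc k).X :=
  hodgeConjectureFor_of_isDivisorGenerated _
    (isDivisorGenerated_powSucc_of_isIsogenous_powSucc_of_isSimple_surface hB hdim hP k)

/-- The census instance `P ~ B⁴ = B.powSucc 3` (the fourth power of a simple abelian surface): every power of `P`
satisfies the Hodge conjecture. [cite: MoonenZarhin1999LowDim, §2 (2.2)] [cite: Abdulali2016TateTwists, §8.1 (2)] -/
theorem hodgeConjectureFor_powSucc_of_isIsogenous_fourthPower_of_isSimple_surface {B : AbelianVariety ℂ}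
    (hB : B.IsSimple) (hdim : B.dim = 2) (hP : P.IsIsogenous (B.powSucc 3)) (k : ℕ) :
    HodgeConjectureFor (P.powSucc k).dim (P.powSucc k).X :=
  hodgeConjectureFor_powSucc_of_isIsogenous_powSucc_of_isSimple_surface hB hdim hP k

/-! ### §3 `P ~ X^{N+1}`, `X` a fourfold with a compatible definite quaternion pair — modulo Floccari–Fu 2026 -/

/-- **THE HODGE CONJECTURE FOR EVERY POWER OF EVERY ABELIAN VARIETY ISOGENOUS TO A POWER OF A FOURFOLD WITH A
COMPATIBLE DEFINITE QUATERNION PAIR** — in particular of a simple type III(1) fourfold, every `(D, T)` — modulo the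
refereed named fact Floccari–Fu 2026 Thm. 1.2 (binder `h5`): ab-weil-2's Lemma R1 (`X` carries a discriminant-1 Weil
structure) + §1. The census shape: the `Q₁₆` Prym locus `(0;4,4,8,8)`, `P_t ~ X_t²`, `End⁰(X_t) ⊇ (-1,-1)_ℚ` acting
through the canonical involution. [cite: FloccariFu2026, Theorem 1.2] [cite: MumfordAV1970, §21 Thm. 2]
[cite: vanGeemen1994HodgeAV, Lemma 3.7 (p. 236)] -/
theorem hodgeConjectureFor_powSucc_of_isIsogenous_powSucc_of_hasCompatibleQuaternionPair
    (h5 : FloccariFu2026_hodgeClasses_algebraic_powers_discOneWeilFourfold) (hX : X.dim = 4)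
    (hQ : HasCompatibleQuaternionPair X) {N : ℕ} (hP : P.IsIsogenous (X.powSucc N)) (k : ℕ) :
    HodgeConjectureFor (P.powSucc k).dim (P.powSucc k).X :=
  hodgeConjectureFor_powSucc_of_isIsogenous_powSucc_of_forall hP
    (hodgeConjectureFor_powSucc_of_floccariFu_of_hasCompatibleQuaternionPair h5 hX hQ) k

/-- The census instance `P ~ X² = X.powSucc 1`: every power of the square-shaped `P` satisfies the Hodge conjecture,
modulo Floccari–Fu 2026 Thm. 1.2; in print also by Abdulali 2002 Cor. 4.3 when `B ∋ √-1` or `√-3`.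
[cite: FloccariFu2026, Theorem 1.2] [cite: Abdulali2016TateTwists, Appendix A 2(a)] -/
theorem hodgeConjectureFor_powSucc_of_isIsogenous_sq_of_hasCompatibleQuaternionPair
    (h5 : FloccariFu2026_hodgeClasses_algebraic_powers_discOneWeilFourfold) (hX : X.dim = 4)
    (hQ : HasCompatibleQuaternionPair X) (hP : P.IsIsogenous (X.powSucc 1)) (k : ℕ) :
    HodgeConjectureFor (P.powSucc k).dim (P.powSucc k).X :=
  hodgeConjectureFor_powSucc_of_isIsogenous_powSucc_of_hasCompatibleQuaternionPair h5 hX hQ hP k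

/-- The same through the atlas sub-cell `Ring2.Atlas.HodgePowersOfDiscOneWeilFourfold` instead of the named fact
(whoever discharges the disc-1 cell settles every power of every such `P`). [cite: FloccariFu2026, Theorem 1.2]
[cite: vanGeemen1994HodgeAV, Lemma 3.7 (p. 236)] -/
theorem hodgeConjectureFor_powSucc_of_isIsogenous_powSucc_of_hasCompatibleQuaternionPair_of_discOneCell
    (h : Ring2.Atlas.HodgePowersOfDiscOneWeilFourfold) (hX : X.dim = 4)
    (hQ : HasCompatibleQuaternionPair X) {N : ℕ} (hP : P.IsIsogenous (X.powSucc N)) (k : ℕ) :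
    HodgeConjectureFor (P.powSucc k).dim (P.powSucc k).X :=
  hodgeConjectureFor_powSucc_of_isIsogenous_powSucc_of_forall hP
    (hodgeConjectureFor_powSucc_of_hodgePowersOfDiscOneWeilFourfold_of_hasDiscOneWeilStructure h X hX
      (hasDiscOneWeilStructure_of_hasCompatibleQuaternionPair hX hQ)) k

end Summit.HodgeConjecture.HodgeConjecture.Ring2.WeilCoverage

end
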